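/-
Copyright (c) 2026 the pub-hodgecm-mathlib formalisation cell (harness21).  Prover seat hodgecm-mathlib-LH4-p11 (g2), req620 Track A «(D-RAM) FOUR-FRAME» squad
(unit U3_Laws, (R-17) «NI2 ⊕ MS», MS ROAD A; brick B9-0 «THE POLARISATION FIBRE IS ONE `S_F`-COSET» — the GENERIC HALF for every vertex type, and the reduction of the
(O2c)∕(O2b) one-coset binder `hcoset` to a UNIQUENESS statement (LH4-p10 (g2) B9-0 SCOPE NOTE 2026-09-03T23:57:56Z: at `tv = 2` uniqueness is stratum-wise, from the twins)).  2026-09-04.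
-/
import Summits.HodgeConjecture.HodgeConjecture.Theorems.F0P3cDyRamDiagonalSelfDualFibre   -- ★ (3b) p855307 (LH4-p10): `isVertexLattice_zero_diagonal_mul_of_mapGL_diagonal_eq` (type 0); brings ★ `mapGL_latt_eq_latt_iff`, ★ `isIntMatrix_mul`, ★ `v_det_eq_one_of_isIntMatrix_inv`
import Summits.HodgeConjecture.HodgeConjecture.Theorems.F0P3cDyRamDiagonalTorusDefs       -- ★ DEFS LEAF p855572 (LH4-p11): `diagGLUnits`, `fixedUnitStabilizer`, `normalisedStableLattices`
import HarnessLib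

/-!
# Crux `H413`, line LH4 «(D-RAM) FOUR-FRAME» road — unit U3_Laws (iii), MS ROAD A, brick B9-0: THE POLARISATIONS OF A LATTICE AS A VERTEX OF TYPE `t` —
# a stabilising `σ`-fixed unit diagonal MOVES the form (every `t`), so the one-coset binder `hcoset` of (O2b)∕(O2c) REDUCES TO UNIQUENESS

Cell `hodgecm-mathlib` (D-0151), FLOOR 0, crux item H413 = `stmt-HodgeConjecture-24833`, route of record `HCCMUnconditional`; squad F0∕P3c∕LH4 (req618∕req620); registered stub served:
`F0P3cDyRamFourFrameU3.stub_U3_stableModelSum` (MS; tree `Cruxes/H413/Lines/F0_P3c_DyRamFourFrame_U3_Laws.lean` :109).  THEOREMS ONLY (no `def`, no instance, no notation,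
no `sorry`, default heartbeats); lane `--supports stmt-HodgeConjecture-24833 --as helper` (count-neutral).

THE MATHEMATICS (LH4-p10 MEMO v2.1 §T2.0∕T2.4; (O2b) PART 2 ★ p855878 §5 at type 0).  Fix a lattice `M = latt g ≤ K^N`, a vertex type `t` and a `σ`-fixed non-degenerate diagonal
form `diag(D₁)` for which `M` is a type-`t` vertex (Gram matrix `G = g^*·diag(D₁)·g` integral, `ϖG⁻¹` integral, `|det G| = |ϖ|^t`).  For a diagonal `U = diag(u)` with `U·M = M`
the matrix `k := g⁻¹Ug` lies in `GL_N(𝒪)` (★ `mapGL_latt_eq_latt_iff`) and the Gram matrix of `diag(D₁·u) = diag(D₁)·U` in the frame `g` is `G·k`: integral, with `ϖ(Gk)⁻¹ =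
k⁻¹(ϖG⁻¹)` integral and `|det(Gk)| = |det G|` — so `M` is a type-`t` vertex of `diag(D₁·u)` as well (§1; ★ (3b)(ii) is the case `t = 0`, same proof).  Hence the FIBRE
`Δ_t(M) := {D σ-fixed non-degenerate diagonal : M is a type-t vertex of diag D}` is a union of cosets of the `σ`-fixed unit stabiliser `S_F(M) = fixedUnitStabilizer σ M`, and the
ONE-COSET property «`D ∈ Δ_t(M) ⟺ D ∈ D₁·S_F(M)`» (the binder `hcoset` of ★ (O2b) PART 3∕4 and of (O2c) `…DiagonalOrbitCount`) is EQUIVALENT to its forward half, UNIQUENESS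
«`D₁, D ∈ Δ_t(M) ⟹ D ∈ D₁·S_F(M)`» (§2).  At `t = 0` uniqueness holds for every normalised lattice (★ (O2b) PART 2 `fibre_isCoset_zero`); at `t = 2` it is delivered STRATUM-WISE by
the type-2 twins of Stage B (MEMO v2.1: on every genuine stratum the solution set has Haar measure `1∕[U_F : S_F(M)]`), and §3 packages «uniqueness at every `M₀ ∈ 𝓛₀(T)`» into
the exact `hcoset` binder — so each twin owes ONLY a uniqueness lemma on its stratum, and the B9-0₂ assembly is a case split over the type-2 shape list (B3₂).

WHAT IS PROVED (generic valued field `K`, generic `N` in §1–§2, `N = 3`-free throughout; `σ` arbitrary).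
* §1 `isVertexLattice_diagonal_mul_of_mapGL_diagonal_eq` — ANY type `t`: `M` type-`t` for `diag(d)`, `diag(u)·M = M` ⟹ `M` type-`t` for `diag(d·u)`;
  `isVertexLattice_diagonal_mul_of_mem_fixedUnitStabilizer` — the same for `u ∈ fixedUnitStabilizer σ M` (units `Fin N → Kˣ`).
* §2 `isVertexLattice_diagonal_iff_of_unique` — at one lattice: UNIQUENESS ⟹ the one-coset `iff` (the `hcoset` shape of ★ (O2b) PART 3, any `t`).
* §3 `hcoset_of_forall_unique` — over `𝓛₀(T) = normalisedStableLattices T`: uniqueness at every member ⟹ the `hcoset` binder of (O2c) `sum_ncard_fixed_vertices_eq_eight_mul_finsum_stabiliserWeight`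
  VERBATIM (any `T`, any `t`).
HONEST LABEL.  Count-neutral (`--supports`); nothing printed is asserted; (MS) stays a PROVER TARGET (empirical census law); `HC_CM` is proved only modulo the 7 printed citations
(2 remaining named inputs: hLiu418 = `stmt-HodgeConjecture-24832`, h413 = `stmt-HodgeConjecture-24833`) until rung 0 closes.

## References
* [Jacobowitz1962] R. Jacobowitz, *Hermitian forms over local fields*, Amer. J. Math. 84 (1962), §4, §7 (Gram matrices of hermitian lattices, modular∕unimodular lattices, change of frame).
* [Kottwitz1986BaseChangeUnits] R. E. Kottwitz, *Base change for unit elements of Hecke algebras*, Compositio Math. 60 (1986), §1 pp. 240–241 (lattice counts modulo the torus).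
* [Serre1980Trees] J.-P. Serre, *Trees*, Springer (1980), Ch. II §1.1 (`GL_N(𝒪)` is the stabiliser of `𝒪^N`; lattices `g·𝒪^N`).
-/

set_option autoImplicit false

noncomputable section

namespace Summit.HodgeConjecture.HodgeConjecture.Cruxes.H413.F0P3cDyRamDiagonalPolarisationCoset

open Matrix
open Literature.NumberTheory.Automorphic Literature.NumberTheory.Automorphic.HermitianLattice Literature.NumberTheory.Automorphic.UnitaryGroup
open Literature.NumberTheory.Automorphic.UnitaryLatticeTree
open Summit.HodgeConjecture.HodgeConjecture.Cruxes.H413.F0P3cDyRamDiagonalTorusDefs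
open scoped Valued WithZero Matrix MatrixGroups

variable {K : Type*} [Field K] [Valued K ℤᵐ⁰] {N : ℕ}

/-! ## §1  A stabilising diagonal moves the form — every vertex type -/

/-- **A DIAGONAL STABILISER MOVES THE FORM, ANY TYPE `t`.**  If `M` is a type-`t` vertex lattice of `diag(d)` and `diag(u)·M = M`, then `M` is a type-`t` vertex lattice of
`diag(d_i·u_i)`: with `M = g·𝒪^N` and `k := g⁻¹·diag(u)·g ∈ GL_N(𝒪)` (★ `mapGL_latt_eq_latt_iff`), the new Gram matrix is `Gram_d(g)·k` — integral, `ϖ·(Gram·k)⁻¹ = k⁻¹·(ϖ·Gram⁻¹)`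
integral, `|det| ` unchanged (`|det k| = 1`).  ★ (3b)(ii) `isVertexLattice_zero_diagonal_mul_of_mapGL_diagonal_eq` is the case `t = 0`; same proof, generic `N`.
[cite: Jacobowitz1962, §4, §7] [cite: Serre1980Trees, II §1.1] -/
theorem isVertexLattice_diagonal_mul_of_mapGL_diagonal_eq {σ : K →+* K} {ϖ : K} {d u : Fin N → K} {t : ℕ}
    {M : Submodule 𝒪[K] (Fin N → K)} (hM : IsVertexLattice σ ϖ (Matrix.diagonal d) t M)
    (U : GL (Fin N) K) (hU : (U : Matrix (Fin N) (Fin N) K) = Matrix.diagonal u) (hfix : mapGL U M = M) :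
    IsVertexLattice σ ϖ (Matrix.diagonal fun i => d i * u i) t M := by
  obtain ⟨g, rfl, hG, hG', hdet⟩ := hM
  obtain ⟨hk, hk'⟩ := (mapGL_latt_eq_latt_iff U g).1 hfix
  set k : GL (Fin N) K := g⁻¹ * U * g with hk_def
  have hkinv : (g⁻¹ * U⁻¹ * g : GL (Fin N) K) = k⁻¹ := by rw [hk_def]; group
  rw [hkinv] at hk'
  -- the new Gram matrix is the old one times `k`
  have hgram : formCongr σ g (Matrix.diagonal fun i => d i * u i) = formCongr σ g (Matrix.diagonal d) * (k : Matrix (Fin N) (Fin N) K) := by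
    have hdiag : (Matrix.diagonal fun i => d i * u i : Matrix (Fin N) (Fin N) K) = Matrix.diagonal d * (U : Matrix (Fin N) (Fin N) K) := by
      rw [hU, Matrix.diagonal_mul_diagonal]
    simp only [hk_def, Units.val_mul, formCongr, hdiag, Matrix.mul_assoc, Units.mul_inv_cancel_left]
  have hdetk : Valued.v (k : Matrix (Fin N) (Fin N) K).det = 1 := v_det_eq_one_of_isIntMatrix_inv hk hk'
  refine ⟨g, rfl, ?_, ?_, ?_⟩
  · rw [hgram]; exact isIntMatrix_mul hG hk
  · rw [hgram, Matrix.mul_inv_rev, ← Matrix.coe_units_inv, ← Matrix.mul_smul]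
    exact isIntMatrix_mul hk' hG'
  · rw [hgram, Matrix.det_mul, map_mul, hdet, hdetk, mul_one]

/-- **… FOR A `σ`-FIXED UNIT STABILISER `u ∈ S_F(M) = fixedUnitStabilizer σ M`** (units `Fin N → Kˣ`): `M` type-`t` for `diag(D₁)` ⟹ `M` type-`t` for `diag(D₁·u)`.  This is
the direction «`D₁·S_F(M) ⊆ Δ_t(M)`» of the one-coset property, valid for EVERY lattice and EVERY type. [cite: Jacobowitz1962, §4, §7] [cite: Kottwitz1986BaseChangeUnits, §1 pp. 240–241] -/
theorem isVertexLattice_diagonal_mul_of_mem_fixedUnitStabilizer (σ : K →+* K) {ϖ : K} {D₁ : Fin N → K} {t : ℕ}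
    {M : Submodule 𝒪[K] (Fin N → K)} (hM : IsVertexLattice σ ϖ (Matrix.diagonal D₁) t M)
    {u : Fin N → Kˣ} (hu : u ∈ fixedUnitStabilizer σ M) :
    IsVertexLattice σ ϖ (Matrix.diagonal fun i => D₁ i * (u i : K)) t M :=
  isVertexLattice_diagonal_mul_of_mapGL_diagonal_eq hM (diagGLUnits u) (coe_diagGLUnits u) ((mem_fixedUnitStabilizer_iff σ M u).1 hu).1

/-! ## §2  At one lattice: uniqueness ⟹ the one-coset `iff` (the `hcoset` shape of ★ (O2b) PART 3) -/

/-- **UNIQUENESS ⟹ ONE COSET.**  At a lattice `M` which is a type-`t` vertex of the `σ`-fixed non-degenerate `diag(D₁)`: if every `σ`-fixed non-degenerate `diag(D)` having `M` as a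
type-`t` vertex is of the form `D = D₁·u` with `u ∈ S_F(M)` (UNIQUENESS), then for every `σ`-fixed non-degenerate `D`: `M` is type-`t` for `diag(D)` IFF `D ∈ D₁·S_F(M)` — the
converse being §1.  This is exactly the `hcoset` clause of ★ (O2b) PART 3 `finsum_ncard_fibre_mul_relIndex_eq_of_exists` at `M`. [cite: Jacobowitz1962, §7] [cite: Kottwitz1986BaseChangeUnits, §1 pp. 240–241] -/
theorem isVertexLattice_diagonal_iff_of_unique (σ : K →+* K) {ϖ : K} {t : ℕ} {M : Submodule 𝒪[K] (Fin N → K)}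
    {D₁ : Fin N → K} (hV₁ : IsVertexLattice σ ϖ (Matrix.diagonal D₁) t M)
    (huniq : ∀ D : Fin N → K, (∀ i, σ (D i) = D i ∧ D i ≠ 0) → IsVertexLattice σ ϖ (Matrix.diagonal D) t M →
      ∃ u ∈ fixedUnitStabilizer σ M, ∀ i, D i = D₁ i * (u i : Kˣ))
    (D : Fin N → K) (hD : ∀ i, σ (D i) = D i ∧ D i ≠ 0) :
    IsVertexLattice σ ϖ (Matrix.diagonal D) t M ↔ ∃ u ∈ fixedUnitStabilizer σ M, ∀ i, D i = D₁ i * (u i : Kˣ) := by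
  refine ⟨huniq D hD, ?_⟩
  rintro ⟨u, hu, hDu⟩
  have hfun : (fun i => D₁ i * (u i : K)) = D := funext fun i => (hDu i).symm
  exact hfun ▸ isVertexLattice_diagonal_mul_of_mem_fixedUnitStabilizer σ hV₁ hu

/-! ## §3  Over `𝓛₀(T)`: uniqueness at every member ⟹ the `hcoset` binder of (O2c) verbatim -/

/-- **THE `hcoset` BINDER OF (O2c) FROM UNIQUENESS ON `𝓛₀(T)`.**  For any `T` and any type `t`: if at every `M₀ ∈ normalisedStableLattices T` two `σ`-fixed non-degenerate diagonal
polarisations of type `t` differ by an element of `S_F(M₀)` (UNIQUENESS — at `t = 2` the stratum-wise content of the type-2 twins, MEMO v2.1 §T2.2–T2.3), then the one-coset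
clause `hcoset` of (O2c) `…DiagonalOrbitCount.sum_ncard_fixed_vertices_eq_eight_mul_finsum_stabiliserWeight` holds at every `M₀ ∈ 𝓛₀(T)`, token for token.
[cite: Kottwitz1986BaseChangeUnits, §1 pp. 240–241] [cite: Jacobowitz1962, §7] -/
theorem hcoset_of_forall_unique (σ : K →+* K) (ϖ : K) (T : GL (Fin N) K) (t : ℕ)
    (huniq : ∀ M₀ ∈ normalisedStableLattices T, ∀ D₁ : Fin N → K, (∀ i, σ (D₁ i) = D₁ i ∧ D₁ i ≠ 0) →
      IsVertexLattice σ ϖ (Matrix.diagonal D₁) t M₀ → ∀ D : Fin N → K, (∀ i, σ (D i) = D i ∧ D i ≠ 0) →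
        IsVertexLattice σ ϖ (Matrix.diagonal D) t M₀ → ∃ u ∈ fixedUnitStabilizer σ M₀, ∀ i, D i = D₁ i * (u i : Kˣ)) :
    ∀ M₀ ∈ normalisedStableLattices T, ∀ D₁ : Fin N → K, (∀ i, σ (D₁ i) = D₁ i ∧ D₁ i ≠ 0) →
      IsVertexLattice σ ϖ (Matrix.diagonal D₁) t M₀ → ∀ D : Fin N → K, (∀ i, σ (D i) = D i ∧ D i ≠ 0) →
        (IsVertexLattice σ ϖ (Matrix.diagonal D) t M₀ ↔ ∃ u ∈ fixedUnitStabilizer σ M₀, ∀ i, D i = D₁ i * (u i : Kˣ)) :=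
  fun M₀ hM₀ D₁ hD₁ hV₁ D hD =>
    isVertexLattice_diagonal_iff_of_unique σ hV₁ (fun D' hD' hV' => huniq M₀ hM₀ D₁ hD₁ hV₁ D' hD' hV') D hD

end Summit.HodgeConjecture.HodgeConjecture.Cruxes.H413.F0P3cDyRamDiagonalPolarisationCoset

end
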